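import Summits.NavierStokesRegularity.NavierStokesRegularity.Theorems.PoloidalWindowDoorPoloidalWindowRigidityZShockRotatingProfileFlux
import HarnessLib

/-!
# Crux K2 `PoloidalWindowRigidity` (stmt-NavierStokesRegularity-19708), line `z_shock` — R3 inhabitant census: ROTATING PATTERNS of the
# autonomous thick height-evolution (V) — commutation of the radial and angular derivatives, and the exact ANGULAR-MOMENTUM LAW on circles

`--supports stmt-NavierStokesRegularity-19708 --as helper` (leafhand-ns-poloidalwindowdoor-3 g9, cell decomp-ns, 2026-08-31).  Class-free,
def-free; Mathlib + parts I/II/IV (`…ZShockRotatingProfile{,LogPolar,Flux}`).  **No stub and no summit is closed by this file; Navier–Stokes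
regularity is NOT proved here (rung 0).**

WHY THIS FILE.  For the exterior radius-as-time problem of a rotating pattern (`X(γ(Ψ)XΨ) = Θ((ω²|y|² − γ(Ψ))ΘΨ)`, parts I–IV; evidence #46
ROTATING-ENTRANCE-leafhand-3-g9.md §3, brick F2) the one integral law that is EXACT — no non-autonomous source from the growing drift `ω²|y|²` —
is the angular-momentum law (rotation about the axis is an exact symmetry of the profile equation).  Its only source is the cubic genuinely
nonlinear term `γ'(Ψ)·ΘΨ·((ΘΨ)² + (XΨ)²)`, which is what a LEAD's cumulative-steepening argument has to control:

* `fderiv_fderiv_symm` — symmetry of second derivatives of a `C²` function on the plane in the nested-`fderiv` vocabulary of the stubs;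
  `radial_angular_commute` — `X(ΘΨ) = Θ(XΨ)` (`[X, Θ] = 0`: dilations commute with rotations);
* `fderiv_normSq_angular` — `D(|·|²)(x)[Jx] = 0`;
* ★ `angularMomentum_identity` — **pointwise law**: for a `C²` solution of the profile equation (`γ ∈ C¹`),
  `X(γ(Ψ)·XΨ·ΘΨ) = Θ(½[(ω²|y|² − γ(Ψ))(ΘΨ)² + γ(Ψ)(XΨ)²]) − ½ γ'(Ψ)·ΘΨ·((ΘΨ)² + (XΨ)²)`
  (in log-polar variables: `∂_ρ(γΨ_ρΨ_θ) = ∂_θ(½[(ω²e^{2ρ} − γ)Ψ_θ² + γΨ_ρ²]) − ½γ'(Ψ)Ψ_θ(Ψ_θ² + Ψ_ρ²)`);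
* ★ `circle_angularMomentum_law` — **integrated law**: with `P r α = (r cos α, r sin α)`, `u α = (cos α, sin α)`, for every `r`,
  `r · d/dr ∫₀^{2π} (γ(Ψ)·XΨ·ΘΨ)(P r α) dα = −½ ∫₀^{2π} (γ'(Ψ)·ΘΨ·((ΘΨ)² + (XΨ)²))(P r α) dα`
  (the derivative being `∫₀^{2π} D(γ(Ψ)XΨΘΨ)(P r α)[u α] dα`, `hasDerivAt_circle_angularMomentum`).  For `γ' ≡ 0` (the linear, (TH)-like case)
  the angular-momentum flux `∮ γΨ_ρΨ_θ` is therefore constant in the radius (and `= 0`, its value on the axis).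

Elementary (product rules, symmetry of mixed partials, FTC on circles, dominated differentiation from part IV); no rigidity is proved.
presearch: none needed beyond parts I–IV. [folklore]
-/

noncomputable section

namespace Summit.NavierStokesRegularity.NavierStokesRegularity.Theorems.PoloidalWindowDoorPoloidalWindowRigidityZShockRotatingProfileAngularMomentum

-- the summit and its single sub-problem share the name (CONVENTIONS §1)
set_option linter.dupNamespace false

open Set Filter Topology Function MeasureTheory intervalIntegral
open Summit.NavierStokesRegularity.NavierStokesRegularity.Theorems.PoloidalWindowDoorPoloidalWindowRigidityZShockRotatingProfile
open Summit.NavierStokesRegularity.NavierStokesRegularity.Theorems.PoloidalWindowDoorPoloidalWindowRigidityZShockRotatingProfileLogPolar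
open Summit.NavierStokesRegularity.NavierStokesRegularity.Theorems.PoloidalWindowDoorPoloidalWindowRigidityZShockRotatingProfileFlux

variable {Ψ : EuclideanSpace ℝ (Fin 2) → ℝ} {γ : ℝ → ℝ} {ω : ℝ}
  {J : EuclideanSpace ℝ (Fin 2) → EuclideanSpace ℝ (Fin 2)} {P : ℝ → ℝ → EuclideanSpace ℝ (Fin 2)} {u : ℝ → EuclideanSpace ℝ (Fin 2)}

/-! ### Mixed partials and the commutation `[X, Θ] = 0` -/

/-- **Symmetry of second derivatives** in the nested-`fderiv` vocabulary: for `C²` `Ψ` and vectors `v, w`,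
`D(x' ↦ DΨ(x')[v])(x)[w] = D(x' ↦ DΨ(x')[w])(x)[v]`. [folklore] -/
theorem fderiv_fderiv_symm (hΨ : ContDiff ℝ 2 Ψ) (x v w : EuclideanSpace ℝ (Fin 2)) :
    fderiv ℝ (fun x' => fderiv ℝ Ψ x' v) x w = fderiv ℝ (fun x' => fderiv ℝ Ψ x' w) x v := by
  have hD : DifferentiableAt ℝ (fderiv ℝ Ψ) x :=
    ((hΨ.fderiv_right (m := 1) le_rfl).differentiable one_ne_zero) x
  have hsymm : IsSymmSndFDerivAt ℝ Ψ x := (hΨ.contDiffAt).isSymmSndFDerivAt (by simp)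
  rw [fderiv_clm_apply hD (differentiableAt_const v), fderiv_clm_apply hD (differentiableAt_const w)]
  simp only [fderiv_fun_const, Pi.zero_apply, ContinuousLinearMap.comp_zero, zero_add,
    ContinuousLinearMap.flip_apply]
  exact hsymm w v

/-- **`X(ΘΨ) = Θ(XΨ)`**: the radial (Euler) derivative `XΨ(x') = DΨ(x')[x']` and the angular derivative `ΘΨ(x') = DΨ(x')[Jx']` commute on
`C²` functions (the first-order parts `DΨ[Jx]` agree and the second-order parts are `D²Ψ[x, Jx] = D²Ψ[Jx, x]`). [folklore] -/
theorem radial_angular_commute (hΨ : ContDiff ℝ 2 Ψ)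
    (hJ : ∀ y' : EuclideanSpace ℝ (Fin 2), J y' = (-(y' 1)) • EuclideanSpace.single (0 : Fin 2) (1 : ℝ) +
      (y' 0) • EuclideanSpace.single (1 : Fin 2) (1 : ℝ))
    (x : EuclideanSpace ℝ (Fin 2)) :
    fderiv ℝ (fun x' => fderiv ℝ Ψ x' (J x')) x x = fderiv ℝ (fun x' => fderiv ℝ Ψ x' x') x (J x) := by
  have hJ0 : ∀ y' : EuclideanSpace ℝ (Fin 2), J y' 0 = -(y' 1) := fun y' => by rw [hJ]; simp
  have hJ1 : ∀ y' : EuclideanSpace ℝ (Fin 2), J y' 1 = y' 0 := fun y' => by rw [hJ]; simp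
  have hDΨ : ContDiff ℝ 1 (fderiv ℝ Ψ) := hΨ.fderiv_right (m := 1) le_rfl
  set u₀ : EuclideanSpace ℝ (Fin 2) → ℝ := fun x' => fderiv ℝ Ψ x' (EuclideanSpace.single 0 1) with hu₀_def
  set u₁ : EuclideanSpace ℝ (Fin 2) → ℝ := fun x' => fderiv ℝ Ψ x' (EuclideanSpace.single 1 1) with hu₁_def
  have hu₀d : Differentiable ℝ u₀ := (hDΨ.clm_apply contDiff_const).differentiable one_ne_zero
  have hu₁d : Differentiable ℝ u₁ := (hDΨ.clm_apply contDiff_const).differentiable one_ne_zero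
  have hP0 := hasFDerivAt_coord_zero x
  have hP1 := hasFDerivAt_coord_one x
  have hΘfun : (fun x' => fderiv ℝ Ψ x' (J x')) = fun x' => -(x' 1) * u₀ x' + x' 0 * u₁ x' := by
    funext x'; rw [fderiv_apply_coord x' (J x'), hJ0, hJ1]
  have hΘ : HasFDerivAt (fun x' => -(x' 1) * u₀ x' + x' 0 * u₁ x')
      ((-(x 1)) • fderiv ℝ u₀ x + u₀ x • (-(EuclideanSpace.proj (𝕜 := ℝ) (1 : Fin 2) : EuclideanSpace ℝ (Fin 2) →L[ℝ] ℝ)) +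
        ((x 0) • fderiv ℝ u₁ x + u₁ x • (EuclideanSpace.proj (𝕜 := ℝ) (0 : Fin 2) : EuclideanSpace ℝ (Fin 2) →L[ℝ] ℝ))) x :=
    (hP1.neg.mul (hu₀d x).hasFDerivAt).add (hP0.mul (hu₁d x).hasFDerivAt)
  have hXfun : (fun x' => fderiv ℝ Ψ x' x') = fun x' => x' 0 * u₀ x' + x' 1 * u₁ x' := by
    funext x'; rw [fderiv_apply_coord x' x']
  have hX : HasFDerivAt (fun x' => x' 0 * u₀ x' + x' 1 * u₁ x')
      ((x 0) • fderiv ℝ u₀ x + u₀ x • (EuclideanSpace.proj (𝕜 := ℝ) (0 : Fin 2) : EuclideanSpace ℝ (Fin 2) →L[ℝ] ℝ) +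
        ((x 1) • fderiv ℝ u₁ x + u₁ x • (EuclideanSpace.proj (𝕜 := ℝ) (1 : Fin 2) : EuclideanSpace ℝ (Fin 2) →L[ℝ] ℝ))) x :=
    (hP0.mul (hu₀d x).hasFDerivAt).add (hP1.mul (hu₁d x).hasFDerivAt)
  have hsym : fderiv ℝ u₀ x (EuclideanSpace.single 1 1) = fderiv ℝ u₁ x (EuclideanSpace.single 0 1) :=
    fderiv_fderiv_symm hΨ x _ _
  rw [hΘfun, hXfun, hΘ.fderiv, hX.fderiv]
  simp only [add_apply, smul_apply, neg_apply, smul_eq_mul, proj_zero_apply, proj_one_apply, hJ0, hJ1]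
  rw [fderiv_apply_coord (Ψ := u₀) x x, fderiv_apply_coord (Ψ := u₁) x x, fderiv_apply_coord (Ψ := u₀) x (J x),
    fderiv_apply_coord (Ψ := u₁) x (J x), hJ0, hJ1, hsym]
  ring

/-- **`D(|·|²)(x)[Jx] = 0`**: the squared radius is constant along rotation orbits. [folklore] -/
theorem fderiv_normSq_angular
    (hJ : ∀ y' : EuclideanSpace ℝ (Fin 2), J y' = (-(y' 1)) • EuclideanSpace.single (0 : Fin 2) (1 : ℝ) +
      (y' 0) • EuclideanSpace.single (1 : Fin 2) (1 : ℝ))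
    (x : EuclideanSpace ℝ (Fin 2)) : fderiv ℝ (fun x' : EuclideanSpace ℝ (Fin 2) => ‖x'‖ ^ 2) x (J x) = 0 := by
  have hJ0 : ∀ y' : EuclideanSpace ℝ (Fin 2), J y' 0 = -(y' 1) := fun y' => by rw [hJ]; simp
  have hJ1 : ∀ y' : EuclideanSpace ℝ (Fin 2), J y' 1 = y' 0 := fun y' => by rw [hJ]; simp
  have hnfun : (fun x' : EuclideanSpace ℝ (Fin 2) => ‖x'‖ ^ 2) = fun x' => x' 0 * x' 0 + x' 1 * x' 1 := by
    funext x'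
    rw [EuclideanSpace.norm_eq, Real.sq_sqrt (Finset.sum_nonneg fun i _ => sq_nonneg _), Fin.sum_univ_two]
    simp [Real.norm_eq_abs, sq]
  have hP0 := hasFDerivAt_coord_zero x
  have hP1 := hasFDerivAt_coord_one x
  have hn : HasFDerivAt (fun x' : EuclideanSpace ℝ (Fin 2) => x' 0 * x' 0 + x' 1 * x' 1)
      (x 0 • (EuclideanSpace.proj (𝕜 := ℝ) (0 : Fin 2) : EuclideanSpace ℝ (Fin 2) →L[ℝ] ℝ) +
        x 0 • (EuclideanSpace.proj (𝕜 := ℝ) (0 : Fin 2) : EuclideanSpace ℝ (Fin 2) →L[ℝ] ℝ) +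
        (x 1 • (EuclideanSpace.proj (𝕜 := ℝ) (1 : Fin 2) : EuclideanSpace ℝ (Fin 2) →L[ℝ] ℝ) +
          x 1 • (EuclideanSpace.proj (𝕜 := ℝ) (1 : Fin 2) : EuclideanSpace ℝ (Fin 2) →L[ℝ] ℝ))) x :=
    (hP0.mul hP0).add (hP1.mul hP1)
  rw [hnfun, hn.fderiv]
  simp only [add_apply, smul_apply, smul_eq_mul, proj_zero_apply, proj_one_apply, hJ0, hJ1]
  ring

/-! ### The angular-momentum law -/

/-- ★ **The pointwise angular-momentum law.**  Let the `C²` profile `Ψ` solve the rotating-pattern equation `ω² ΘΘΨ = Σᵢ ∂ᵢ(γ(Ψ)∂ᵢΨ)`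
(`γ ∈ C¹`).  Then at every `x`:
`X(γ(Ψ)·XΨ·ΘΨ)(x) = Θ(½[(ω²|·|² − γ(Ψ))(ΘΨ)² + γ(Ψ)(XΨ)²])(x) − ½ γ'(Ψ(x))·ΘΨ(x)·((ΘΨ x)² + (XΨ x)²)`.
Proof: `X(γXΨ·ΘΨ) = X(γXΨ)·ΘΨ + γXΨ·X(ΘΨ)`, then the radius-as-time equation `X(γXΨ) = Θ((ω²|·|²−γ)ΘΨ)`, the commutation
`X(ΘΨ) = Θ(XΨ)`, `Θ(|·|²) = 0` and the product rule. [folklore] -/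
theorem angularMomentum_identity (hΨ : ContDiff ℝ 2 Ψ) (hγ : ContDiff ℝ 1 γ)
    (hJ : ∀ y' : EuclideanSpace ℝ (Fin 2), J y' = (-(y' 1)) • EuclideanSpace.single (0 : Fin 2) (1 : ℝ) +
      (y' 0) • EuclideanSpace.single (1 : Fin 2) (1 : ℝ))
    (hrot : ∀ y : EuclideanSpace ℝ (Fin 2),
      ω ^ 2 * fderiv ℝ (fun y' => fderiv ℝ Ψ y' (J y')) y (J y) =
        ∑ i, fderiv ℝ (fun y' => γ (Ψ y') * fderiv ℝ Ψ y' (EuclideanSpace.single i 1)) y (EuclideanSpace.single i 1))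
    (x : EuclideanSpace ℝ (Fin 2)) :
    fderiv ℝ (fun x' => γ (Ψ x') * fderiv ℝ Ψ x' x' * fderiv ℝ Ψ x' (J x')) x x =
      fderiv ℝ (fun x' => (1 / 2 : ℝ) * ((ω ^ 2 * ‖x'‖ ^ 2 - γ (Ψ x')) * fderiv ℝ Ψ x' (J x') ^ 2 +
          γ (Ψ x') * fderiv ℝ Ψ x' x' ^ 2)) x (J x) -
        (1 / 2 : ℝ) * deriv γ (Ψ x) * fderiv ℝ Ψ x (J x) * (fderiv ℝ Ψ x (J x) ^ 2 + fderiv ℝ Ψ x x ^ 2) := by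
  -- regularity
  have hJ' : J = fun y' => (-(y' 1)) • EuclideanSpace.single (0 : Fin 2) (1 : ℝ) +
      (y' 0) • EuclideanSpace.single (1 : Fin 2) (1 : ℝ) := funext hJ
  have hJc : ContDiff ℝ 1 J := by rw [hJ']; fun_prop
  have hΨd : Differentiable ℝ Ψ := hΨ.differentiable two_ne_zero
  have hΨ1 : ContDiff ℝ 1 Ψ := hΨ.of_le one_le_two
  have hDΨ : ContDiff ℝ 1 (fderiv ℝ Ψ) := hΨ.fderiv_right (m := 1) le_rfl
  have hγd : Differentiable ℝ γ := hγ.differentiable one_ne_zero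
  have hXd : Differentiable ℝ fun x' => fderiv ℝ Ψ x' x' := (hDΨ.clm_apply contDiff_id).differentiable one_ne_zero
  have hΘd : Differentiable ℝ fun x' => fderiv ℝ Ψ x' (J x') := (hDΨ.clm_apply hJc).differentiable one_ne_zero
  have hnd : Differentiable ℝ fun x' : EuclideanSpace ℝ (Fin 2) => ‖x'‖ ^ 2 := (contDiff_norm_sq ℝ (n := 1)).differentiable one_ne_zero
  have hg : HasFDerivAt (fun x' => γ (Ψ x')) (deriv γ (Ψ x) • fderiv ℝ Ψ x) x :=
    (hγd (Ψ x)).hasDerivAt.comp_hasFDerivAt x (hΨd x).hasFDerivAt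
  have hGd : Differentiable ℝ fun x' => γ (Ψ x') * fderiv ℝ Ψ x' x' := ((hγd.comp hΨd).mul hXd)
  -- names for the derivative maps (opaque continuous linear maps)
  have hX' : HasFDerivAt (fun x' => fderiv ℝ Ψ x' x') (fderiv ℝ (fun x' => fderiv ℝ Ψ x' x') x) x := (hXd x).hasFDerivAt
  have hΘ' : HasFDerivAt (fun x' => fderiv ℝ Ψ x' (J x')) (fderiv ℝ (fun x' => fderiv ℝ Ψ x' (J x')) x) x := (hΘd x).hasFDerivAt
  have hn' : HasFDerivAt (fun x' : EuclideanSpace ℝ (Fin 2) => ‖x'‖ ^ 2) (fderiv ℝ (fun x' : EuclideanSpace ℝ (Fin 2) => ‖x'‖ ^ 2) x) x :=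
    (hnd x).hasFDerivAt
  have hG' : HasFDerivAt (fun x' => γ (Ψ x') * fderiv ℝ Ψ x' x') (fderiv ℝ (fun x' => γ (Ψ x') * fderiv ℝ Ψ x' x') x) x :=
    (hGd x).hasFDerivAt
  have hm : HasFDerivAt (fun x' => ω ^ 2 * ‖x'‖ ^ 2 - γ (Ψ x'))
      (ω ^ 2 • fderiv ℝ (fun x' : EuclideanSpace ℝ (Fin 2) => ‖x'‖ ^ 2) x - deriv γ (Ψ x) • fderiv ℝ Ψ x) x :=
    (hn'.const_mul (ω ^ 2)).sub hg
  -- the left-hand side: `X(γXΨ·ΘΨ) = X(γXΨ)·ΘΨ + γXΨ·X(ΘΨ)`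
  have hL : HasFDerivAt (fun x' => γ (Ψ x') * fderiv ℝ Ψ x' x' * fderiv ℝ Ψ x' (J x'))
      ((γ (Ψ x) * fderiv ℝ Ψ x x) • fderiv ℝ (fun x' => fderiv ℝ Ψ x' (J x')) x +
        fderiv ℝ Ψ x (J x) • fderiv ℝ (fun x' => γ (Ψ x') * fderiv ℝ Ψ x' x') x) x := hG'.mul hΘ'
  -- the angular flux `(ω²|·|² − γ(Ψ))·ΘΨ` and its derivative (for the radius-as-time equation)
  have hB : HasFDerivAt (fun x' => (ω ^ 2 * ‖x'‖ ^ 2 - γ (Ψ x')) * fderiv ℝ Ψ x' (J x'))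
      ((ω ^ 2 * ‖x‖ ^ 2 - γ (Ψ x)) • fderiv ℝ (fun x' => fderiv ℝ Ψ x' (J x')) x +
        fderiv ℝ Ψ x (J x) • (ω ^ 2 • fderiv ℝ (fun x' : EuclideanSpace ℝ (Fin 2) => ‖x'‖ ^ 2) x - deriv γ (Ψ x) • fderiv ℝ Ψ x)) x :=
    hm.mul hΘ'
  -- the right-hand side density `½[(ω²|·|² − γ(Ψ))(ΘΨ)² + γ(Ψ)(XΨ)²]`
  have hRfun : (fun x' => (1 / 2 : ℝ) * ((ω ^ 2 * ‖x'‖ ^ 2 - γ (Ψ x')) * fderiv ℝ Ψ x' (J x') ^ 2 +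
      γ (Ψ x') * fderiv ℝ Ψ x' x' ^ 2)) = fun x' => (1 / 2 : ℝ) * ((ω ^ 2 * ‖x'‖ ^ 2 - γ (Ψ x')) *
        (fderiv ℝ Ψ x' (J x') * fderiv ℝ Ψ x' (J x')) + γ (Ψ x') * (fderiv ℝ Ψ x' x' * fderiv ℝ Ψ x' x')) := by
    funext x'; ring
  have hR : HasFDerivAt (fun x' => (1 / 2 : ℝ) * ((ω ^ 2 * ‖x'‖ ^ 2 - γ (Ψ x')) *
        (fderiv ℝ Ψ x' (J x') * fderiv ℝ Ψ x' (J x')) + γ (Ψ x') * (fderiv ℝ Ψ x' x' * fderiv ℝ Ψ x' x')))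
      ((1 / 2 : ℝ) • (((ω ^ 2 * ‖x‖ ^ 2 - γ (Ψ x)) • (fderiv ℝ Ψ x (J x) • fderiv ℝ (fun x' => fderiv ℝ Ψ x' (J x')) x +
          fderiv ℝ Ψ x (J x) • fderiv ℝ (fun x' => fderiv ℝ Ψ x' (J x')) x) +
          (fderiv ℝ Ψ x (J x) * fderiv ℝ Ψ x (J x)) •
            (ω ^ 2 • fderiv ℝ (fun x' : EuclideanSpace ℝ (Fin 2) => ‖x'‖ ^ 2) x - deriv γ (Ψ x) • fderiv ℝ Ψ x)) +
        (γ (Ψ x) • (fderiv ℝ Ψ x x • fderiv ℝ (fun x' => fderiv ℝ Ψ x' x') x +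
          fderiv ℝ Ψ x x • fderiv ℝ (fun x' => fderiv ℝ Ψ x' x') x) +
          (fderiv ℝ Ψ x x * fderiv ℝ Ψ x x) • (deriv γ (Ψ x) • fderiv ℝ Ψ x)))) x :=
    ((hm.mul (hΘ'.mul hΘ')).add (hg.mul (hX'.mul hX'))).const_mul (1 / 2 : ℝ)
  -- the three structural inputs
  have hpde := rotating_profile_equation_logpolar hΨ hγ hJ hrot x
  have hsym := radial_angular_commute hΨ hJ x
  have hn0 := fderiv_normSq_angular hJ x
  rw [hB.fderiv] at hpde
  rw [hL.fderiv, hRfun, hR.fderiv]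
  simp only [add_apply, sub_apply, smul_apply, smul_eq_mul] at hpde ⊢
  rw [hn0] at hpde ⊢
  rw [hpde, hsym]
  ring

/-! ### The angular-momentum law on circles -/

/-- **Radial derivative of the angular-momentum flux on a circle** (dominated differentiation, part IV). [folklore] -/
theorem hasDerivAt_circle_angularMomentum (hΨ : ContDiff ℝ 2 Ψ) (hγ : ContDiff ℝ 1 γ)
    (hJ : ∀ y' : EuclideanSpace ℝ (Fin 2), J y' = (-(y' 1)) • EuclideanSpace.single (0 : Fin 2) (1 : ℝ) +
      (y' 0) • EuclideanSpace.single (1 : Fin 2) (1 : ℝ))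
    (hP : ∀ r α, P r α = (r * Real.cos α) • EuclideanSpace.single (0 : Fin 2) (1 : ℝ) + (r * Real.sin α) • EuclideanSpace.single (1 : Fin 2) (1 : ℝ))
    (hu : ∀ α, u α = Real.cos α • EuclideanSpace.single (0 : Fin 2) (1 : ℝ) + Real.sin α • EuclideanSpace.single (1 : Fin 2) (1 : ℝ))
    (r : ℝ) :
    HasDerivAt (fun r' => ∫ α in (0 : ℝ)..2 * Real.pi, γ (Ψ (P r' α)) * fderiv ℝ Ψ (P r' α) (P r' α) * fderiv ℝ Ψ (P r' α) (J (P r' α)))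
      (∫ α in (0 : ℝ)..2 * Real.pi,
        fderiv ℝ (fun x' => γ (Ψ x') * fderiv ℝ Ψ x' x' * fderiv ℝ Ψ x' (J x')) (P r α) (u α)) r := by
  have hJ' : J = fun y' => (-(y' 1)) • EuclideanSpace.single (0 : Fin 2) (1 : ℝ) +
      (y' 0) • EuclideanSpace.single (1 : Fin 2) (1 : ℝ) := funext hJ
  have hJc : ContDiff ℝ 1 J := by rw [hJ']; fun_prop
  have hΨ1 : ContDiff ℝ 1 Ψ := hΨ.of_le one_le_two
  have hDΨ : ContDiff ℝ 1 (fderiv ℝ Ψ) := hΨ.fderiv_right (m := 1) le_rfl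
  have hG2 : ContDiff ℝ 1 fun x' => γ (Ψ x') * fderiv ℝ Ψ x' x' * fderiv ℝ Ψ x' (J x') :=
    ((hγ.comp hΨ1).mul (hDΨ.clm_apply contDiff_id)).mul (hDΨ.clm_apply hJc)
  exact hasDerivAt_circleIntegral hG2 hP hu r

/-- ★ **The angular-momentum law on circles.**  Let the `C²` profile `Ψ` solve the rotating-pattern equation (`γ ∈ C¹`).  Then for every
radius `r`:
`r · ∫₀^{2π} D(γ(Ψ)XΨΘΨ)(P r α)[u α] dα = −½ ∫₀^{2π} γ'(Ψ)·ΘΨ·((ΘΨ)² + (XΨ)²) (P r α) dα`,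
the left integral being the radial derivative of the angular-momentum flux `∫₀^{2π} (γ(Ψ)XΨΘΨ)(P r α) dα`
(`hasDerivAt_circle_angularMomentum`).  No term from the non-autonomous drift `ω²|y|²` survives: the only source is the cubic genuinely
nonlinear one. [folklore] -/
theorem circle_angularMomentum_law (hΨ : ContDiff ℝ 2 Ψ) (hγ : ContDiff ℝ 1 γ)
    (hJ : ∀ y' : EuclideanSpace ℝ (Fin 2), J y' = (-(y' 1)) • EuclideanSpace.single (0 : Fin 2) (1 : ℝ) +
      (y' 0) • EuclideanSpace.single (1 : Fin 2) (1 : ℝ))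
    (hP : ∀ r α, P r α = (r * Real.cos α) • EuclideanSpace.single (0 : Fin 2) (1 : ℝ) + (r * Real.sin α) • EuclideanSpace.single (1 : Fin 2) (1 : ℝ))
    (hu : ∀ α, u α = Real.cos α • EuclideanSpace.single (0 : Fin 2) (1 : ℝ) + Real.sin α • EuclideanSpace.single (1 : Fin 2) (1 : ℝ))
    (hrot : ∀ y : EuclideanSpace ℝ (Fin 2),
      ω ^ 2 * fderiv ℝ (fun y' => fderiv ℝ Ψ y' (J y')) y (J y) =
        ∑ i, fderiv ℝ (fun y' => γ (Ψ y') * fderiv ℝ Ψ y' (EuclideanSpace.single i 1)) y (EuclideanSpace.single i 1))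
    (r : ℝ) :
    r * ∫ α in (0 : ℝ)..2 * Real.pi,
        fderiv ℝ (fun x' => γ (Ψ x') * fderiv ℝ Ψ x' x' * fderiv ℝ Ψ x' (J x')) (P r α) (u α) =
      -(1 / 2 : ℝ) * ∫ α in (0 : ℝ)..2 * Real.pi,
        deriv γ (Ψ (P r α)) * fderiv ℝ Ψ (P r α) (J (P r α)) *
          (fderiv ℝ Ψ (P r α) (J (P r α)) ^ 2 + fderiv ℝ Ψ (P r α) (P r α) ^ 2) := by
  -- regularity
  have hJ' : J = fun y' => (-(y' 1)) • EuclideanSpace.single (0 : Fin 2) (1 : ℝ) +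
      (y' 0) • EuclideanSpace.single (1 : Fin 2) (1 : ℝ) := funext hJ
  have hJc : ContDiff ℝ 1 J := by rw [hJ']; fun_prop
  have hΨ1 : ContDiff ℝ 1 Ψ := hΨ.of_le one_le_two
  have hDΨ : ContDiff ℝ 1 (fderiv ℝ Ψ) := hΨ.fderiv_right (m := 1) le_rfl
  have hγΨ : ContDiff ℝ 1 fun y' => γ (Ψ y') := hγ.comp hΨ1
  have hXc : ContDiff ℝ 1 fun x' => fderiv ℝ Ψ x' x' := hDΨ.clm_apply contDiff_id
  have hΘc : ContDiff ℝ 1 fun x' => fderiv ℝ Ψ x' (J x') := hDΨ.clm_apply hJc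
  have hF : ContDiff ℝ 1 fun x' => (1 / 2 : ℝ) * ((ω ^ 2 * ‖x'‖ ^ 2 - γ (Ψ x')) * fderiv ℝ Ψ x' (J x') ^ 2 +
      γ (Ψ x') * fderiv ℝ Ψ x' x' ^ 2) :=
    contDiff_const.mul ((((contDiff_const.mul (contDiff_norm_sq ℝ (n := 1))).sub hγΨ).mul (hΘc.pow 2)).add (hγΨ.mul (hXc.pow 2)))
  have hPc : Continuous fun α => P r α := (continuous_polar hP).comp (continuous_const.prodMk continuous_id)
  have hJcont : Continuous J := hJc.continuous
  -- pull `r` inside and use `P = r • u`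
  rw [← intervalIntegral.integral_const_mul, ← intervalIntegral.integral_const_mul]
  have h1 : (fun α => r * fderiv ℝ (fun x' => γ (Ψ x') * fderiv ℝ Ψ x' x' * fderiv ℝ Ψ x' (J x')) (P r α) (u α)) =
      fun α => fderiv ℝ (fun x' => (1 / 2 : ℝ) * ((ω ^ 2 * ‖x'‖ ^ 2 - γ (Ψ x')) * fderiv ℝ Ψ x' (J x') ^ 2 +
          γ (Ψ x') * fderiv ℝ Ψ x' x' ^ 2)) (P r α) (J (P r α)) +
        -(1 / 2 : ℝ) * (deriv γ (Ψ (P r α)) * fderiv ℝ Ψ (P r α) (J (P r α)) *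
          (fderiv ℝ Ψ (P r α) (J (P r α)) ^ 2 + fderiv ℝ Ψ (P r α) (P r α) ^ 2)) := by
    funext α
    rw [← smul_eq_mul (a := r), ← map_smul, ← polar_eq_smul hP hu r α, angularMomentum_identity hΨ hγ hJ hrot (P r α)]
    ring
  rw [h1]
  have hint1 : IntervalIntegrable (fun α => fderiv ℝ (fun x' => (1 / 2 : ℝ) * ((ω ^ 2 * ‖x'‖ ^ 2 - γ (Ψ x')) *
      fderiv ℝ Ψ x' (J x') ^ 2 + γ (Ψ x') * fderiv ℝ Ψ x' x' ^ 2)) (P r α) (J (P r α))) volume (0 : ℝ) (2 * Real.pi) :=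
    (((hF.continuous_fderiv one_ne_zero).comp hPc).clm_apply (hJcont.comp hPc)).intervalIntegrable _ _
  have hcub : Continuous fun α => deriv γ (Ψ (P r α)) * fderiv ℝ Ψ (P r α) (J (P r α)) *
      (fderiv ℝ Ψ (P r α) (J (P r α)) ^ 2 + fderiv ℝ Ψ (P r α) (P r α) ^ 2) := by
    have hγ'c : Continuous (deriv γ) := hγ.continuous_deriv le_rfl
    have hΘP : Continuous fun α => fderiv ℝ Ψ (P r α) (J (P r α)) := hΘc.continuous.comp hPc
    have hXP : Continuous fun α => fderiv ℝ Ψ (P r α) (P r α) := hXc.continuous.comp hPc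
    exact ((hγ'c.comp (hΨ.continuous.comp hPc)).mul hΘP).mul ((hΘP.pow 2).add (hXP.pow 2))
  have hint2 : IntervalIntegrable (fun α => -(1 / 2 : ℝ) * (deriv γ (Ψ (P r α)) * fderiv ℝ Ψ (P r α) (J (P r α)) *
      (fderiv ℝ Ψ (P r α) (J (P r α)) ^ 2 + fderiv ℝ Ψ (P r α) (P r α) ^ 2))) volume (0 : ℝ) (2 * Real.pi) :=
    (continuous_const.mul hcub).intervalIntegrable _ _
  rw [intervalIntegral.integral_add hint1 hint2, integral_angularDeriv_eq_zero hF hP hJ r, zero_add]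

end Summit.NavierStokesRegularity.NavierStokesRegularity.Theorems.PoloidalWindowDoorPoloidalWindowRigidityZShockRotatingProfileAngularMomentum
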